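import Literature.RepresentationTheory.MoeglinVignerasWaldspurger1987.RankOneThetaLift
import Literature.NumberTheory.GelbartRogawski1991.LocalSchrodingerFixedVectorsFinite
import Literature.NumberTheory.Automorphic.UnitaryGroupLocalExpansionNonsplit
import Literature.NumberTheory.Automorphic.FiniteAdeleSchrodingerFactorwise
import Literature.NumberTheory.Automorphic.AdmissibleSubquotient
import HarnessLib

/-!
# PROOF of [MVW 1987, Chap. 3 §IV.4 Théorème principal 2) a)] in the rank-one case at a non-split place:
# the theta lift of a character of the compact `U(1) = E_v¹` to `U(J)(F_v)` is ADMISSIBLE (`mvw_IV4_rankOne_admissible_holds`)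

Topic `RepresentationTheory/MoeglinVignerasWaldspurger1987`; namespace `Literature.RepresentationTheory.MoeglinVignerasWaldspurger1987`.
KERNEL ONLY: theorems; no definition, no named fact, no record, no `sorry`.  This file DISCHARGES the named fact
`mvw_IV4_rankOne_admissible` of `RankOneThetaLift.lean` (tree convention `…_holds`).

[MoeglinVignerasWaldspurger1987, Chap. 3 §IV.4 Théorème principal 2) a)] «En général, `ϑ_{m'}(π)` est de longueur finie» (with 1) a):
the lift of a cuspidal — here: any character `χ` of the COMPACT `U(W) = E_v¹` — is irreducible or zero), i.e. the word «admissible»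
of [Liu2021, App. D Lemma D.1, first sentence]: the representation of `U(J)(F_v)` on the `χ`-coinvariants of `ω_s` under the
centre `E_v¹` is admissible.  The printed proofs go through Kudla's filtration of Jacquet modules; the proof formalised here is
the elementary one available because `U(W)` is compact (the lattice-model support bound, [MoeglinVignerasWaldspurger1987,
Chap. 2 II.8], [Howe1979, §2]):

* §1 **`isAdmissible_weil_localPi_of_isField`** — at a NON-SPLIT place the smooth Weil representation `ω_s = ω_ψ ∘ s` of the
  whole group `U(J)(F_v)` on `𝒮(F_vᴺ)` is ALREADY admissible, for every splitting `s` over `ι_v`: for a compact open `K`,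
  shrink to `K₁ = K ∩ Stab(1_{𝒪_vᴺ})` (open by smoothness); the Heisenberg translations by the box
  `{(x, y) : x ∈ 𝒪_vᴺ, 𝕋_v y ∈ 𝒪_vᴺ}` fix `1_{𝒪_vᴺ}` (`localSchrodinger_unitVec`); the EXPANSION PROPERTY of `U(J)(F_v)` at a non-split
  place (`UnitaryGroup.exists_expansion_of_isField`: every far-out `w ∈ 𝕎_v` is moved by some `k ∈ K₁` by a small vector with
  non-trivial Heisenberg phase — unitary quasi-reflections close to `1` and the anisotropy of the norm form of the FIELD `E_v`)
  feeds the engine `finite_fixedPoints_of_expansion` (`GelbartRogawski1991/LocalSchrodingerFixedVectorsFinite.lean`), so the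
  `K₁`-fixed, hence the `K`-fixed, vectors are finite-dimensional.  (At a split place this is false: `U(J)(F_v) ≅ GL_N(F_v)`
  preserves a Lagrangian and `ω_s` restricted to it is not admissible.)
* §2 **`mvw_IV4_rankOne_admissible_holds`** — the `χ`-coinvariants are a QUOTIENT of `ω_s` by a `U(J)(F_v)`-stable subspace
  (`TwistedCoinv.mk` intertwines), and quotients of admissible representations are admissible
  (`Representation.IsAdmissible.of_surjective`, [BernsteinZelevinsky1976, §2]).

Nothing of the cited sources is asserted; HC_CM is not mentioned further and is NOT proved by anything here.

## References
* [MoeglinVignerasWaldspurger1987] C. Mœglin, M.-F. Vignéras, J.-L. Waldspurger, LNM 1291 (1987), Chap. 2 II.8; Chap. 3 §IV.4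
  Théorème principal 1) a), 2) a).
* [Liu2021] Y. Liu, Camb. J. Math. 9 (2021), App. D Lemma D.1 (first sentence), p. 125.
* [Howe1979] R. Howe, *θ-series and invariant theory*, Proc. Symp. Pure Math. 33.1 (1979), §2.
* [BernsteinZelevinsky1976] I. N. Bernstein, A. V. Zelevinsky, Russian Math. Surveys 31:3 (1976), §2.1–2.3.
-/

set_option autoImplicit false

noncomputable section

open NumberField IsDedekindDomain
open scoped Matrix
open Literature.RepresentationTheory.HeisenbergGroup (MpPsi ofSymplectic polar)
open Literature.NumberTheory.GelbartRogawski1991.UnitaryDualPair.LocalSplitting (iota LocalMp localSchrodinger localPairing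
  localGram finite_fixedPoints_of_expansion)
open Literature.NumberTheory.Automorphic (SchwartzBruhat UnitaryGroup.localPi UnitaryGroup.localCenter UnitaryGroup.LocalRing
  UnitaryGroup.localCenter_comm primePowBall piPrimePowBall unitVec integralBox localSchrodinger_unitVec
  mem_piPrimePowBall_iff mem_integralBox_iff isOpen_piPrimePowBall isCompact_piPrimePowBall zero_mem_piPrimePowBall
  exists_mem_piPrimePowBall dotProduct_mem_primePowBall primePowBall_antitone mem_primePowBall_zero_iff zero_mem_integralBox
  unitVec_apply_of_mem)
open Literature.NumberTheory.Automorphic.UnitaryGroup (exists_expansion_of_isField)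

namespace Literature.RepresentationTheory.MoeglinVignerasWaldspurger1987

/-! ## §1 The Weil representation of `U(J)(F_v)` is admissible at a non-split place -/

/-- **At a NON-SPLIT finite place, the smooth Weil representation of `U(J)(F_v)` on `𝒮(F_vᴺ)` is admissible** — for every
splitting `s : U(J)(F_v) → S̃p_{ψ_v}(𝕎_v)` over `ι_v` with `ω_s = ω_ψ ∘ s` smooth and `E_v` a field: the `K`-fixed vectors of a
compact open `K` are finite-dimensional (lattice-model support bound: `finite_fixedPoints_of_expansion` fed by the expansion
property `exists_expansion_of_isField` of `U(J)(F_v)` on `𝕎_v` and the vector `1_{𝒪_vᴺ}`).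
[cite: MoeglinVignerasWaldspurger1987, Chap. 3 §IV.4 Théorème principal 2) a)] -/
theorem isAdmissible_weil_localPi_of_isField (F : Type) [Field F] [NumberField F] (E : Type) [Field E] [NumberField E]
    [Algebra F E] [Algebra.IsQuadraticExtension F E] (c : E ≃ₐ[F] E) (N : ℕ) (δ : E) (hcδ : c δ = -δ) (hδ : δ ≠ 0) (d : F)
    (hd : δ * δ = algebraMap F E d) (T : Matrix (Fin N) (Fin N) F) (hT : T.IsSymm) (hTd : IsUnit T.det)
    (J : Matrix (Fin N) (Fin N) E) (hJ : J = T.map (algebraMap F E)) (v : HeightOneSpectrum (𝓞 F))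
    (hE : IsField (UnitaryGroup.LocalRing E v))
    (s : UnitaryGroup.localPi E c N J v →* LocalMp F N T v)
    (hs : ∀ g, MpPsi.proj _ (s g) = iota F E c N hcδ hδ hd T hT hJ v g)
    (hsm : Representation.IsSmooth ((MpPsi.toRep (localSchrodinger F N T v)).comp s)) :
    Representation.IsAdmissible ((MpPsi.toRep (localSchrodinger F N T v)).comp s) := by
  classical
  refine ⟨hsm, fun K hK => ?_⟩
  -- the test vector `φ₀ = 1_{𝒪_vᴺ}` and the open subgroup `K₁ = K ∩ Stab(φ₀)`
  have hφ₀ : unitVec F (Fin N) v ≠ 0 := by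
    intro h0
    have h1 := unitVec_apply_of_mem (zero_mem_integralBox F (Fin N) v)
    rw [h0] at h1
    exact one_ne_zero (h1.symm.trans rfl)
  obtain ⟨K₁, hK₁⟩ : ∃ K₁ : Subgroup (UnitaryGroup.localPi E c N J v), K₁ = (K : Subgroup _) ⊓
      Representation.stabilizerSubgroup ((MpPsi.toRep (localSchrodinger F N T v)).comp s) (unitVec F (Fin N) v) := ⟨_, rfl⟩
  have hK₁o : IsOpen (K₁ : Set (UnitaryGroup.localPi E c N J v)) := hK₁ ▸ K.isOpen.inter (hsm (unitVec F (Fin N) v))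
  have hK₁φ : ∀ k ∈ K₁, MpPsi.toRep _ (s k) (unitVec F (Fin N) v) = unitVec F (Fin N) v := fun k hk =>
    (Representation.mem_stabilizerSubgroup _ _ k).1 (hK₁ ▸ hk).2
  -- the box `(𝔭^{n})^N × (𝔭^{n})^N` of Heisenberg translations fixing `φ₀`: `n` with all `𝕋_v`-entries in `𝔭^{-n}`
  obtain ⟨nT, hnT⟩ := exists_mem_piPrimePowBall (F := v.adicCompletion F)
    (fun p : Fin N × Fin N => localGram F N T v p.1 p.2)
  have hΛ : ∀ a ∈ piPrimePowBall (v.adicCompletion F) (Fin N) (nT : ℤ) ×ˢ piPrimePowBall (v.adicCompletion F) (Fin N) (nT : ℤ),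
      localSchrodinger F N T v ⟨a, 0⟩ (unitVec F (Fin N) v) = unitVec F (Fin N) v := by
    rintro ⟨x, y⟩ ⟨hx, hy⟩
    refine localSchrodinger_unitVec T v (fun i => ?_) (fun i => ?_)
    · rw [← mem_primePowBall_zero_iff]
      exact primePowBall_antitone (Int.natCast_nonneg nT) ((mem_piPrimePowBall_iff).1 hx i)
    · rw [← mem_primePowBall_zero_iff, Matrix.mulVec, show (0 : ℤ) = -(nT : ℤ) + nT by ring]
      exact dotProduct_mem_primePowBall ((mem_piPrimePowBall_iff).2 fun l => (mem_piPrimePowBall_iff).1 hnT (i, l)) hy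
  -- the expansion property of `U(J)(F_v)` at the non-split place, for `K₁` and the exponent `nT`
  obtain ⟨M, hM⟩ := exists_expansion_of_isField E c hcδ hδ hd T hT hTd hJ v hE K₁ hK₁o (nT : ℤ)
  haveI hfin : Module.Finite ℂ (Representation.fixedPoints ((MpPsi.toRep (localSchrodinger F N T v)).comp s) K₁) :=
    finite_fixedPoints_of_expansion hTd s K₁ hφ₀ hK₁φ
      ((isOpen_piPrimePowBall _).prod (isOpen_piPrimePowBall _))
      ⟨zero_mem_piPrimePowBall _, zero_mem_piPrimePowBall _⟩ hΛ
      ((isCompact_piPrimePowBall _).prod (isCompact_piPrimePowBall _))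
      (Ω := piPrimePowBall (v.adicCompletion F) (Fin N) M ×ˢ piPrimePowBall (v.adicCompletion F) (Fin N) M)
      (fun w hw => (hM w hw).imp fun k hk => ⟨hk.1, by rw [hs k]; exact hk.2⟩)
  -- `K₁ ≤ K`, so the `K`-fixed vectors sit inside the `K₁`-fixed ones
  have hle : Representation.fixedPoints ((MpPsi.toRep (localSchrodinger F N T v)).comp s) (K : Subgroup _) ≤
      Representation.fixedPoints ((MpPsi.toRep (localSchrodinger F N T v)).comp s) K₁ :=
    Representation.fixedPoints_antitone _ (hK₁ ▸ inf_le_left)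
  exact Submodule.finiteDimensional_of_le hle

/-! ## §2 The theta lift `Θ(χ)` is admissible -/

/-- **[MVW 1987, Chap. 3 §IV.4 Théorème principal 2) a)], rank-one case, non-split place — PROVED**: for every splitting
`s` over `ι_v` with `ω_s` smooth, every hermitian line `J₁` and every unitary continuous character `χ` of `U(J₁)(F_v) = E_v¹`,
the representation of `U(J)(F_v)` on the `χ`-coinvariants of `ω_s` under the centre is ADMISSIBLE: it is a quotient of the
admissible `ω_s` (`isAdmissible_weil_localPi_of_isField`) by a stable subspace.  Discharges the named fact
`mvw_IV4_rankOne_admissible`. [cite: MoeglinVignerasWaldspurger1987, Chap. 3 §IV.4 Théorème principal 2) a)] -/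
theorem mvw_IV4_rankOne_admissible_holds : mvw_IV4_rankOne_admissible := by
  intro F _ _ E _ _ _ _ c N δ hcδ hδ d hd T hT hTd J hJ v hE s hs hsm J₁ hJ₁ χ _ _
  have hadm := isAdmissible_weil_localPi_of_isField F E c N δ hcδ hδ d hd T hT hTd J hJ v hE s hs hsm
  refine hadm.of_surjective
    ((TwistedCoinv.mk _ χ).intertwiningMap_of_isIntertwiningMap _ _ fun g f => ?_) (TwistedCoinv.mk_surjective _ χ)
  exact (TwistedCoinv.rep_mk χ _ _ g f).symm

end Literature.RepresentationTheory.MoeglinVignerasWaldspurger1987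

end
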